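import Summits.ResolutionOfSingularities.ResolutionOfSingularities.Theorems.FrobeniusLadderFInjectiveMacaulayficationFTemkinClosedPointsFibre
import Summits.ResolutionOfSingularities.ResolutionOfSingularities.Theorems.FrobeniusLadderFInjectiveMacaulayficationLocalFullificationDimFourFibre
import Summits.ResolutionOfSingularities.ResolutionOfSingularities.Theorems.FrobeniusLadderFInjectiveMacaulayficationRegularBlowupModelDim2
import Summits.ResolutionOfSingularities.ResolutionOfSingularities.Theorems.FrobeniusLadderFInjectiveMacaulayficationRelClosedSubsetFixFinite
import HarnessLib

/-!
# THE CM / F SPLIT OF THE REGISTERED d = 4 RESIDUE (L4♭) `LocalFullificationDimFourFibre`: (L4♭) ⟺ (L4♭-CM) ∧ (L4♭-F)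
# (crux `FInjectiveMacaulayfication` stmt-ResolutionOfSingularities-15315, chain w45a; door v35's research stub
# `stub_localFullificationDimFourFibre`; res-L1-w45a-plan-1 R16.64/R17.1 record «CM-half known (Kawasaki/Česnavičius), F-half open» made a
# kernel statement; seat res-L1-w45a-stub-2 g6, OFFER 00:20Z)

[OURS · L1 W4.5a] Support file (`--supports stmt-ResolutionOfSingularities-15315 --as helper`); TWO `Prop`-valued CANDIDATE statements of OURS
(`@[conjecture] def`, consumed only as hypotheses; no instance, no notation, no named fact) and the PROVED equivalence with (L4♭); replaces the role
of NO printed item; NOT a statement of the manuscript; AI-written (AI review is weaker than expert review).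

THE SPLIT. (L4♭) (`LocalFullificationDimFourFibre.LocalFullificationDimFourFibre`, p586372): a blowing up `g : S′ → Spec 𝒪_{X,x}` (`dim 𝒪_{X,x} = 4`,
`X/k` an integral variety, centre `I ≠ ⊥`) that is REGULAR off its closed fibre admits a fibre-supported centre `𝓚 ≠ ⊥` all of whose blowings up
are FULL (domain ∧ CM-clause ∧ F-clause) at every point.
* (L4♭-CM) `LocalMacaulayficationDimFourFibre` — same data, conclusion «domain ∧ CM-clause at every point» only. This is MACAULAYFICATION of the
  excellent integral 4-dimensional scheme `S′` by ONE blowing up whose centre lies in the closed fibre; since `S′` is regular — hence Cohen–Macaulay —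
  off the closed fibre, it is an instance of Česnavičius's theorem in its blow-up form [Česnavičius 2021, Thm. 5.3 / proof of Thm. 1.6: for a
  CM-excellent locally equidimensional Noetherian `X` there is a closed subscheme `Z ⊂ X` DISJOINT FROM THE CM LOCUS with `Bl_Z X` Cohen–Macaulay]
  — KNOWN IN PRINT; NOT in the tree in this form (the tree's `CesnaviciusMacaulayfication` is the proper-birational variety form without centre
  control, and the formalized Kawasaki centre `kawasakiCentreSheaf` is divisorial), hence typed here as a CANDIDATE of OURS, to be replaced by a
  named fact when the desk files one.
* (L4♭-F) `LocalFInjectivizationDimFourFibre` — (L4♭) with the EXTRA hypothesis that `S′` is Cohen–Macaulay at every point: «a Cohen–Macaulay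
  integral 4-dimensional local blow-up scheme, regular off its closed fibre, is FULL-ified by one fibre-supported blowing up». THE OPEN HALF
  (res-L1-w45a-idea-1's K2WILD and res-L1-w45a-idea-2's ROWC closed-point rows are its instances at `I` Cartier).
* `localFullificationDimFourFibre_iff_split : (L4♭) ↔ (L4♭-CM) ∧ (L4♭-F)` — PROVED. (⇒): FULL ⇒ domain ∧ CM; restriction. (⇐): Macaulayfy
  `S′` by `𝓚₁` (fibre-supported), `S₁ := Bl_{𝓚₁} S′` is again a blowing up of `Spec 𝒪_{X,x}` (Stacks 080B, `IsBlowup.exists_isBlowup_comp_supported`)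
  along a non-zero centre (`RegularBlowupModelDim2.ne_bot_of_isBlowup`), regular off ITS closed fibre (`S₁ → S′` is a local isomorphism off
  `supp 𝓚₁ ⊆` fibre) and Cohen–Macaulay everywhere, so (L4♭-F) gives a fibre-supported `𝓚₂` on `S₁` with `Bl_{𝓚₂} S₁` FULL everywhere; the composite
  `Bl_{𝓚₂} S₁ → S′` is a blowing up along a fibre-supported `𝓚 ≠ ⊥` (080B again, with `T :=` the closed fibre), and EVERY blowing up of `S′` along `𝓚`
  is isomorphic to it over `S′` (`IsBlowup.unique`), so FULL transports (`FTemkinClosedPoints.fullCl_of_isIso_stalkMap'`).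
Upshot for the door: the registered residue `stub_localFullificationDimFourFibre` = {a printed Macaulayfication theorem} ⊔ {(L4♭-F)}; a later
door may register (L4♭-F) alone once (L4♭-CM) is a named fact. ≤ S bookkeeping: (L4♭-F) ≤ (L4♭) ≤ (L4) ≤ S_loc(4) by the ⇒ direction.
[candidate statements, OURS; cite: Cesnavicius2021, Thm. 1.6 and Thm. 5.3 (CM-half, context); Kawasaki2000, Thm. 1.1 (context); StacksProject, Tag 080B; Tag 085U]
-/

-- single-problem summit: the doubled namespace component is forced
set_option linter.dupNamespace false

noncomputable section

open AlgebraicGeometry CategoryTheory CategoryTheory.Limits Literature.AlgebraicGeometry.Resolution TopologicalSpace IsLocalRing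

namespace Summit.ResolutionOfSingularities.ResolutionOfSingularities.Theorems.FInjectiveMacaulayfication.LocalFullificationDimFourFibreSplit

open Summit.ResolutionOfSingularities.ResolutionOfSingularities.Theorems.FInjectiveMacaulayfication
open SliceableCentre

/-! ## §1 The two halves -/

/-- [OURS · CANDIDATE statement, not a fact] **(L4♭-CM) LOCAL MACAULAYFICATION IN DIMENSION FOUR, FIBRE-SUPPORTED CENTRE.** Same data as (L4♭)
`LocalFullificationDimFourFibre` (binders verbatim): `X/k` integral separated of finite type (`char k = p`), `x ∈ X` with `dim 𝒪_{X,x} = 4`,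
`g : S′ → Spec 𝒪_{X,x}` a blowing up along `I ≠ ⊥`, `S′` regular off the closed fibre. Conclusion: an ideal sheaf `𝓚 ≠ ⊥` on `S′` supported in the
closed fibre such that EVERY blowing up `S″ → S′` along `𝓚` has, at EVERY point, a stalk that is a DOMAIN satisfying the CM-clause
(`SliceableCentre.CMCl`: every system of parameters weakly regular). An instance of Česnavičius's Macaulayfication in blow-up form (centre disjoint
from the CM locus, which contains the complement of the closed fibre) — known in print, candidate-tagged here until a named fact is filed.
[candidate statement, OURS; cite: Cesnavicius2021, Thm. 1.6 and Thm. 5.3 (context)] -/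
@[conjecture] def LocalMacaulayficationDimFourFibre : Prop :=
  ∀ (p : ℕ), p.Prime → ∀ (k : Type) [Field k] [CharP k p]
    (X : Scheme.{0}) (f : X ⟶ Spec (.of k)),
      IsSeparated f → LocallyOfFiniteType f → QuasiCompact f → IsIntegral X →
      ∀ x : X, ringKrullDim (X.presheaf.stalk x) = 4 →
      ∀ (S' : Scheme.{0}) (g : S' ⟶ Spec (X.presheaf.stalk x)) (I : (Spec (X.presheaf.stalk x)).IdealSheafData),
        I ≠ ⊥ → IsBlowup g I →
        (∀ s : S', g.base s ≠ closedPoint (X.presheaf.stalk x) → s ∈ Scheme.regularLocus S') →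
        ∃ 𝓚 : S'.IdealSheafData, 𝓚 ≠ ⊥ ∧ (∀ s ∈ (𝓚.support : Set S'), g.base s = closedPoint (X.presheaf.stalk x)) ∧
          ∀ (S'' : Scheme.{0}) (π : S'' ⟶ S'), IsBlowup π 𝓚 →
            ∀ s : S'', IsDomain (S''.presheaf.stalk s) ∧ CMCl (S''.presheaf.stalk s)

/-- [OURS · CANDIDATE statement, not a fact] **(L4♭-F) LOCAL F-INJECTIVISATION OF A COHEN–MACAULAY FOUR-DIMENSIONAL LOCAL BLOW-UP SCHEME,
FIBRE-SUPPORTED CENTRE.** (L4♭) `LocalFullificationDimFourFibre` with ONE extra hypothesis: `S′` satisfies the CM-clause at every point. I.e. for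
`X/k`, `x` (`dim 𝒪_{X,x} = 4`), `g : S′ → Spec 𝒪_{X,x}` a blowing up along `I ≠ ⊥`, `S′` regular off the closed fibre AND Cohen–Macaulay everywhere:
there is `𝓚 ≠ ⊥` supported in the closed fibre such that every blowing up of `S′` along `𝓚` is FULL (`SliceableCentre.FullCl`: domain ∧ CM-clause ∧
Frobenius-closed parameter ideals) at every point. THE OPEN HALF of the d = 4 residue of the crux. [candidate statement, OURS; open] -/
@[conjecture] def LocalFInjectivizationDimFourFibre : Prop :=
  ∀ (p : ℕ), p.Prime → ∀ (k : Type) [Field k] [CharP k p]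
    (X : Scheme.{0}) (f : X ⟶ Spec (.of k)),
      IsSeparated f → LocallyOfFiniteType f → QuasiCompact f → IsIntegral X →
      ∀ x : X, ringKrullDim (X.presheaf.stalk x) = 4 →
      ∀ (S' : Scheme.{0}) (g : S' ⟶ Spec (X.presheaf.stalk x)) (I : (Spec (X.presheaf.stalk x)).IdealSheafData),
        I ≠ ⊥ → IsBlowup g I →
        (∀ s : S', g.base s ≠ closedPoint (X.presheaf.stalk x) → s ∈ Scheme.regularLocus S') →
        (∀ s : S', CMCl (S'.presheaf.stalk s)) →
        ∃ 𝓚 : S'.IdealSheafData, 𝓚 ≠ ⊥ ∧ (∀ s ∈ (𝓚.support : Set S'), g.base s = closedPoint (X.presheaf.stalk x)) ∧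
          ∀ (S'' : Scheme.{0}) (π : S'' ⟶ S'), IsBlowup π 𝓚 →
            ∀ s : S'', FullCl p (S''.presheaf.stalk s)

/-! ## §2 (L4♭) ⇒ each half -/

/-- (L4♭) ⇒ (L4♭-CM): FULL stalks are domains satisfying the CM-clause. [folklore] -/
theorem localMacaulayficationDimFourFibre_of_localFullificationDimFourFibre
    (h : LocalFullificationDimFourFibre.LocalFullificationDimFourFibre) : LocalMacaulayficationDimFourFibre := by
  intro p hp k _ _ X f hsep hft hqc hint x hx S' g I hI hg hreg
  obtain ⟨𝓚, h1, h2, h3⟩ := h p hp k X f hsep hft hqc hint x hx S' g I hI hg hreg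
  exact ⟨𝓚, h1, h2, fun S'' π hπ s => ⟨(h3 S'' π hπ s).1, RelClosedSubsetFixFinite.cmCl_of_fullCl (h3 S'' π hπ s)⟩⟩

/-- (L4♭) ⇒ (L4♭-F): drop the Cohen–Macaulay hypothesis. [folklore] -/
theorem localFInjectivizationDimFourFibre_of_localFullificationDimFourFibre
    (h : LocalFullificationDimFourFibre.LocalFullificationDimFourFibre) : LocalFInjectivizationDimFourFibre := by
  intro p hp k _ _ X f hsep hft hqc hint x hx S' g I hI hg hreg _
  exact h p hp k X f hsep hft hqc hint x hx S' g I hI hg hreg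

/-! ## §3 The two halves ⇒ (L4♭): Macaulayfy, then F-injectivise, and compose the two blowings up -/

set_option maxHeartbeats 800000 in
-- two blow-up existence calls, one 080B composite, one uniqueness transport
/-- **(L4♭-CM) ∧ (L4♭-F) ⇒ (L4♭).** See the module docstring for the proof. [folklore assembly; cite: StacksProject, Tag 080B; Tag 085U] -/
theorem localFullificationDimFourFibre_of_split
    (hCM : LocalMacaulayficationDimFourFibre) (hF : LocalFInjectivizationDimFourFibre) :
    LocalFullificationDimFourFibre.LocalFullificationDimFourFibre := by
  intro p hp k _ _ X f hsep hft hqc hint x hx S' g I hI hg hreg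
  classical
  haveI : IsLocallyNoetherian X := LocallyOfFiniteType.isLocallyNoetherian f
  haveI : IsIntegral S' := hg.isIntegral hI
  haveI : IsProper g := hg.isProper
  haveI : IsLocallyNoetherian S' := LocallyOfFiniteType.isLocallyNoetherian g
  haveI : CompactSpace S' := QuasiCompact.compactSpace_of_compactSpace g
  haveI : IsNoetherian S' := {}
  -- Step 1: Macaulayfy `S'` along a fibre-supported `𝓚₁`
  obtain ⟨𝓚₁, h𝓚₁ne, h𝓚₁fib, h𝓚₁cm⟩ := hCM p hp k X f hsep hft hqc hint x hx S' g I hI hg hreg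
  obtain ⟨S₁, π₁, hπ₁⟩ := exists_isBlowup S' 𝓚₁
  haveI : IsIntegral S₁ := hπ₁.isIntegral h𝓚₁ne
  haveI : IsProper π₁ := hπ₁.isProper
  haveI : IsLocallyNoetherian S₁ := LocallyOfFiniteType.isLocallyNoetherian π₁
  haveI : CompactSpace S₁ := QuasiCompact.compactSpace_of_compactSpace π₁
  haveI : IsNoetherian S₁ := {}
  -- `S₁ → Spec 𝒪_{X,x}` is again a blowing up, along a non-zero centre (080B)
  obtain ⟨I₁, hI₁, -⟩ := hg.exists_isBlowup_comp_supported g I π₁ 𝓚₁ Set.univ (Set.subset_univ _) hπ₁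
    (by rw [Set.preimage_univ]; exact Set.subset_univ _)
  have hI₁ne : I₁ ≠ ⊥ := RegularBlowupModelDim2.ne_bot_of_isBlowup hI₁
  -- the composite structure map, pointwise
  have hcomp : ∀ s : S₁, (π₁ ≫ g).base s = g.base (π₁.base s) := fun s => by
    rw [Scheme.Hom.comp_apply]
  -- `S₁` is regular off its closed fibre: `π₁` is a local isomorphism off `supp 𝓚₁ ⊆` (closed fibre of `S'`)
  have hreg₁ : ∀ s : S₁, (π₁ ≫ g).base s ≠ closedPoint (X.presheaf.stalk x) → s ∈ Scheme.regularLocus S₁ := by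
    intro s hs
    rw [hcomp] at hs
    have hs' : π₁.base s ∉ (𝓚₁.support : Set S') := fun h => hs (h𝓚₁fib _ h)
    haveI := hπ₁.isIso_compl
    exact (mem_regularLocus_iff_of_isIso_morphismRestrict π₁ ⟨(𝓚₁.support : Set S')ᶜ, 𝓚₁.support.isClosed.isOpen_compl⟩ s hs').mpr
      (hreg _ hs)
  -- `S₁` is Cohen–Macaulay everywhere
  have hcm₁ : ∀ s : S₁, CMCl (S₁.presheaf.stalk s) := fun s => (h𝓚₁cm S₁ π₁ hπ₁ s).2
  -- Step 2: F-injectivise `S₁` along a fibre-supported `𝓚₂`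
  obtain ⟨𝓚₂, h𝓚₂ne, h𝓚₂fib, h𝓚₂full⟩ := hF p hp k X f hsep hft hqc hint x hx S₁ (π₁ ≫ g) I₁ hI₁ne hI₁ hreg₁ hcm₁
  obtain ⟨S₂, π₂, hπ₂⟩ := exists_isBlowup S₁ 𝓚₂
  haveI : IsIntegral S₂ := hπ₂.isIntegral h𝓚₂ne
  -- Step 3: the composite `S₂ → S₁ → S'` is a blowing up of `S'` along a FIBRE-SUPPORTED `𝓚 ≠ ⊥` (080B with `T :=` the closed fibre)
  obtain ⟨𝓚, h𝓚, h𝓚T⟩ := hπ₁.exists_isBlowup_comp_supported π₁ 𝓚₁ π₂ 𝓚₂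
    {s : S' | g.base s = closedPoint (X.presheaf.stalk x)} (fun s hs => h𝓚₁fib s hs) hπ₂
    (fun s hs => by
      have h := h𝓚₂fib s hs
      rw [hcomp] at h
      exact h)
  have h𝓚ne : 𝓚 ≠ ⊥ := RegularBlowupModelDim2.ne_bot_of_isBlowup h𝓚
  refine ⟨𝓚, h𝓚ne, fun s hs => h𝓚T hs, fun S'' π hπ s => ?_⟩
  -- Step 4: every blowing up along `𝓚` is `S₂` up to an isomorphism over `S'`; FULL transports along stalk isomorphisms
  obtain ⟨e, -, -⟩ := hπ.unique h𝓚
  exact FTemkinClosedPoints.fullCl_of_isIso_stalkMap' p e.hom s (h𝓚₂full S₂ π₂ hπ₂ (e.hom s))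

/-- **(L4♭) ⟺ (L4♭-CM) ∧ (L4♭-F)**: the registered d = 4 residue of the crux is EXACTLY «fibre-supported local Macaulayfication (known in print)»
plus «fibre-supported local F-injectivisation of Cohen–Macaulay 4-dimensional local blow-up schemes (open)». [folklore assembly] -/
theorem localFullificationDimFourFibre_iff_split :
    LocalFullificationDimFourFibre.LocalFullificationDimFourFibre ↔
      LocalMacaulayficationDimFourFibre ∧ LocalFInjectivizationDimFourFibre :=
  ⟨fun h => ⟨localMacaulayficationDimFourFibre_of_localFullificationDimFourFibre h,
    localFInjectivizationDimFourFibre_of_localFullificationDimFourFibre h⟩,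
    fun h => localFullificationDimFourFibre_of_split h.1 h.2⟩

end Summit.ResolutionOfSingularities.ResolutionOfSingularities.Theorems.FInjectiveMacaulayfication.LocalFullificationDimFourFibreSplit

end
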